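import Summits.AtomisticToContinuum.HydrodynamicLimit.Theorems.ImplosionDichotomyHydroLimitInBandCoreReduction
import Summits.AtomisticToContinuum.HydrodynamicLimit.Theorems.ImplosionDichotomyHydroLimitInBandEntropyDock
import Summits.AtomisticToContinuum.HydrodynamicLimit.Theorems.ImplosionDichotomyHydroLimitInBandActivityTailsOfTransfer
import Summits.AtomisticToContinuum.HydrodynamicLimit.Theorems.ImplosionDichotomyProfilewiseOfInBand
import Summits.AtomisticToContinuum.HydrodynamicLimit.Theses.OneFlightGossipEngine
import Summits.AtomisticToContinuum.HydrodynamicLimit.Theses.TwoClocks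
import Literature.Analysis.FluidPDE.HardSphereCollisionRecord
import Literature.MathematicalPhysics.KineticTheory.HardSphereEulerLLN
import HarnessLib

/-!
# Line `inherited-window-clock` (v1c, reduced import closure: the landed chain `inputs ⇒ Grönwall core` as a sixth stub) — crux `HydroLimitProfilewiseBand` (stmt-AtomisticToContinuum-17372), route ImplosionDichotomy

Crux-strategist `planner-cstrat-stmt-AtomisticToContinuum-17372-0` (gen 1, 2026-08-16). REGISTERED SKELETON.

THE LINE IN ONE SENTENCE. The profile-wise packing-guarded hydrodynamic limit (`∀ profiles ∃ η ∃ σ₀ …`, this crux) is the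
`η := η₀` shadow of the uniform one (`∃ η₀ ∀ profiles …` = `ImplosionDichotomy.HydroLimitInBand`, stmt-9133 = the re-typed
sub-problem Statement verbatim; glue `profilewiseOfInBand_proof`, LANDED p131525), and the uniform one is REDUCED IN THE TREE
(line `IdeatorOneSketch` of stmt-9133, leads -0/c1/c2/c3/c4; heart clauses LANDED p123605 + p127017; window continuity p118327;
`hydroLimitInBand_of_heart` p122696) to the five conjecture-grade INPUTS of Yau's one-window relative-entropy ledger in band.
So the honest skeleton of THIS crux is: the five inputs as registered stubs + a sorry-free composition through the landed heart.
The STRATEGY-CENSUS of this crux (`Cruxes/HydroLimitProfilewiseBand/STRATEGY-CENSUS.md`) records why the `∀∃` weakening has no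
tooth of its own against any of the five inputs (each input's packing threshold is a STATICS radius — cluster / virial analyticity
of the hard-sphere reference law — hence profile-independent by scale invariance of hard cores), so that no stub here can be
weakened to a profile-wise form that would still compose.

STUBS (5 research stubs + in v1b the already-proved heart as a sixth, farm-fallback stub; registered; `sorry` only inside them) — byte-identical in CONTENT with the five children of the SPLIT-REQUEST of
stmt-9133 (strategist s1, `Cruxes/HydroLimitInBand/SPLIT-REQUEST.md`), typed over the EXISTING decls so that they coincide with
staffed items where those exist:
* `stub_kineticCurrentsAlongFamilies : OneFlightGossipEngine.KineticCurrentsLDAlongFamilies` — item stmt-16659 (crux r3 of route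
  OneFlightGossipEngine; `Iff.rfl` with `HydroLimitInBandOfHeart.KineticCurrentsWindowLDFamily`). OPEN-PROBLEM weight (the
  fixed-packing wall in LD currency: N-uniform relaxation of one-body fast kinetic currents over `τ → ∞` mean free times).
* `stub_localClampedTransferAlongFamilies : HydroLimitInBandOfHeart.LocalClampedTransferWindowLDFamily` — not an item anywhere yet
  (requested as a child of 9133 and of OneFlightGossipEngine's dock 16665). OPEN-PROBLEM weight (same wall for clamped collisional
  transfer rows + locality + second-order statics of the centring).
* `stub_coherentSuprathermalW : HydroLimitInBandOfHeart.CoherentSuprathermalContentVanishesW` — not an item yet (bridge to an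
  equilibrium LD filed as crux idea `gibbs-budget-coherence-bridge` on 16665). L–XL.
* `stub_transferActivityTails : TwoClocks.TransferActivityTails` — item stmt-16624 (crux r7 of route TwoClocks); gives CAT (13734)
  ∧ CEAT by the LANDED `HydroLimitInBandHeart.activityTails_of_transferActivityTails` (p126055). L.
* `stub_energyCurrentTails : OneFlightGossipEngine.EnergyCurrentTails` — item stmt-9235 (8 routes). L–XL (no maximum principle for
  hard-sphere energy cascades; exponential version refuted, negatives 14607; UI version standing).

COMPOSITION (kernel-checked, no `sorry` outside the stubs): `HydroLimitProfilewiseBand_of : CoreOfInputs → KCWF → LCTF → CSCV-W → TAT →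
ECT → ImplosionDichotomy.HydroLimitProfilewiseBand` (v1c: `CoreOfInputs := KCWF → LCTF → CSCV-W → TAT → ECT → GronwallCoreInBand`, the LANDED
chain of stmt-9133 — `gronwallCoreInBand_of_heart` p122696 over the heart clauses p123605/p127017 and the window continuity p118327 — carried
as a sixth stub ONLY because the hub's build of `Theorems.OneFlightGossipEngineClampedCurrentsDockReduction` (in the import closure of
`…HydroLimitInBandOfHeart`) has been incoherent since 21:39Z, so the strict gate lane refuses every importer of the in-band chain tonight;
the composition then runs through the two LANDED docks `EntropyClockDock.relEntropyVanishingInBand_of_gronwallCoreInBand` (p97252) and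
`hydroLimitInBand_of_relEntropyVanishingInBand` (p97115) and the `η := η₀` glue, all genuinely used; variants v1b (heart glue as the sixth
stub, imports OfHeart) and v1 (five stubs, imports …WindowClause) are attached as evidence on the item and supersede the sixth stub as soon as
the hub rebuild lands — same stub names and signatures for the five research stubs) = `profilewiseOfInBand_proof ∘ hydroLimitInBand_of_lineInputs`, the latter being the
s1 split glue (`oneWindowLedgerStatic_of_clauses` adapted verbatim from skeleton v11 of 9133, `oneWindowLedger_holds` over the two
LANDED clauses, `hydroLimitInBand_of_heart` + `stub_windowContinuityInBand`). The same glue is pending for Theorems/ as p128579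
(`ImplosionDichotomyHydroLimitInBandSplit.lean`, lead c4 of 9133); when it lands, §2 below can be replaced by one `open`.

DISPROOF USED. This crux has no Disproof.lean yet (item filed 2026-08-16T23:17Z). The sibling's (`Cruxes/HydroLimitInBand/Disproof.lean`,
cdisprove gen 2) transfers verbatim DOWN the one-line implication only for its POSITIVE obstructions: every `_false_without_<H>` /
`_false_with_sigma_zero` theorem about 9133 whose witness is ONE profile (the shear stream at `σ = 0`: `hydroLimitInBand_false_with_sigma_zero`,
p123377; the input-level `kineticCurrentsWindowLDFamily_false_with_sigma_zero` p123458, `…CoherenceInputSigmaZero`) refutes the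
`0 ≤ σ` variant of THIS crux as well (a single bad profile kills `∀ profiles ∃ η …` for every `η`, packing being `0 < η` at `σ = 0`).
Honoured here: every stub carries `0 < σ` with `σ`-dependent thresholds (`∃ σ₀` / `∀ σ, 0 < σ → … ∃ τ₀ ∃ N₀`), none is stated at or
uniformly down to `σ = 0`; no stub is an instance of a landed `Theorems/HydroLimitInBand/Negative/*` lemma (LoadBearing I/II concern
dropping the tie / the balance laws — all stubs keep the `t = 0` tie where they are true-law statements).
-/

noncomputable section

open MeasureTheory Filter Set Topology InformationTheory
open scoped ENNReal

namespace Summit.AtomisticToContinuum.HydrodynamicLimit.Cruxes.HydroLimitProfilewiseBand.InheritedWindowClock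

open Literature.MathematicalPhysics.KineticTheory Literature.Analysis.FluidPDE Literature.Analysis.FunctionSpaces
open Summit.AtomisticToContinuum.HydrodynamicLimit.Theses
open Summit.AtomisticToContinuum.HydrodynamicLimit.Theorems
open Summit.AtomisticToContinuum.HydrodynamicLimit.Theorems.HydroLimitInBandHeart (activityTails_of_transferActivityTails)

/-! ## §0 Statements re-declared VERBATIM from `Theorems/ImplosionDichotomyHydroLimitInBandOfHeart.lean` (byte-identical bodies; that
module cannot be imported in the strict lane tonight, see the module docstring) -/

/-- **The GUARDED GRONWALL CORE** (Yau's relative-entropy estimate along a handed-over reference, in band) — verbatim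
`HydroLimitInBandOfHeart.GronwallCoreInBand` = the hypothesis of the landed `EntropyClockDock.relEntropyVanishingInBand_of_gronwallCoreInBand`. -/
def GronwallCoreInBand : Prop :=
  ∃ ηc : ℝ, 0 < ηc ∧ ∀ (a₀ θ₀ : T3 → ℝ) (u₀ : T3 → V3), Continuous a₀ → Continuous θ₀ → Continuous u₀ →
    (∀ x, 0 < a₀ x) → (∀ x, 0 < θ₀ x) → ∃ σ₀ : ℝ, 0 < σ₀ ∧ ∀ σ : ℝ, 0 < σ → σ < σ₀ →
    ∀ (T : ℝ) (ρ θ : ℝ → T3 → ℝ) (u : ℝ → T3 → V3), IsHardSphereEulerSolution σ T ρ u θ →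
    (∀ t ∈ Set.Ico 0 T, ∀ x, ρ t x * σ ^ 3 < ηc) →
    ∀ Φ : (N : ℕ) → HardSphereFlow (Torus.geometry (Fin 3)) (hsDiameter σ N) (N + 1),
    TendstoHydroFieldsAt (fun N => localGibbsLaw σ a₀ u₀ θ₀ N (Φ N)) Φ ρ u θ 0 →
    ∀ t ∈ Set.Ioo 0 T, ∀ (a : T3 → ℝ) (hac : Continuous a) (hap : ∀ x, 0 < a x),
      (∀ x, ρ t x ≤ a x ∧ a x ≤ 2 * ρ t x) → SmallDensity (profileOf a hac hap) σ →
      rhoLim (profileOf a hac hap) σ = ρ t →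
      Tendsto (fun N : ℕ => klDiv ((Φ N).lawAt (localGibbsLaw σ a₀ u₀ θ₀ N (Φ N)) t)
        (localGibbsLaw σ a (u t) (θ t) N (Φ N)) / ((N : ℝ≥0∞) + 1)) atTop (𝓝 0)

/-- **CSCV-W** — verbatim `HydroLimitInBandOfHeart.CoherentSuprathermalContentVanishesW` (child 3 of the 9133 SPLIT-REQUEST). -/
def CoherentSuprathermalContentVanishesW : Prop :=
  ∀ (a₀ θ₀ : T3 → ℝ) (u₀ : T3 → V3), Continuous a₀ → Continuous θ₀ → Continuous u₀ →
    (∀ x, 0 < a₀ x) → (∀ x, 0 < θ₀ x) →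
    ∃ σ₀ : ℝ, 0 < σ₀ ∧ ∀ σ : ℝ, 0 < σ → σ < σ₀ →
    ∀ (T : ℝ) (ρ θ : ℝ → T3 → ℝ) (u : ℝ → T3 → V3), IsHardSphereEulerSolution σ T ρ u θ →
    ∀ Φ : (N : ℕ) → HardSphereFlow (Torus.geometry (Fin 3)) (hsDiameter σ N) (N + 1),
    TendstoHydroFieldsAt (fun N => localGibbsLaw σ a₀ u₀ θ₀ N (Φ N)) Φ ρ u θ 0 →
    ∀ t ∈ Set.Ico 0 T, ∃ Kstar : ℝ, 0 < Kstar ∧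
    ∀ R : ℝ → T3 → ℝ → ℝ, Measurable (fun p : ℝ × T3 × ℝ => R p.1 p.2.1 p.2.2) →
    (∀ s x s', s' ≤ Kstar ^ 2 → R s x s' = 0) → (∀ s x s', |R s x s'| ≤ |s'|) →
    ∀ η : ℝ, 0 < η → ∀ ε : ℝ, 0 < ε →
    ∃ τ₀ : ℝ, 0 < τ₀ ∧ ∀ τ : ℝ, τ₀ ≤ τ → ∃ N₀ : ℕ, ∀ N : ℕ, N₀ ≤ N → ∀ s ∈ Set.Icc 0 t,
      (let w : ℝ := τ * ((N : ℝ) + 1) ^ (-(1 / 3 : ℝ))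
       let P := localGibbsLaw σ a₀ u₀ θ₀ N (Φ N)
       let W := fun (i : Fin (N + 1)) (s r : ℝ) (z : Config (N + 1) (Fin 3) T3) =>
         ((Φ N).flow r z i).2 - u s ((Φ N).flow r z i).1
       let cub := fun (i : Fin (N + 1)) (s : ℝ) (z : Config (N + 1) (Fin 3) T3) =>
         w⁻¹ * ∫ r in s..(s + w), ‖W i s r z‖ ^ 3
       let cubHi := fun (i : Fin (N + 1)) (s : ℝ) (z : Config (N + 1) (Fin 3) T3) =>
         w⁻¹ * ∫ r in s..(s + w), (if Kstar < ‖W i s r z‖ then ‖W i s r z‖ ^ 3 else 0)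
       let qbar := fun (i : Fin (N + 1)) (s : ℝ) (z : Config (N + 1) (Fin 3) T3) =>
         w⁻¹ • ∫ r in s..(s + w), (R s ((Φ N).flow r z i).1 (‖W i s r z‖ ^ 2)) • W i s r z
       ∫⁻ z, ENNReal.ofReal (((N : ℝ) + 1)⁻¹ * ∑ i : Fin (N + 1),
              (if η * cub i s z < ‖qbar i s z‖ then cubHi i s z else 0)) ∂P ≤ ENNReal.ofReal ε)

/-- **LCTF** — verbatim `HydroLimitInBandOfHeart.LocalClampedTransferWindowLDFamily` (child 2 of the 9133 SPLIT-REQUEST). -/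
def LocalClampedTransferWindowLDFamily : Prop :=
  ∃ η₀ : ℝ, 0 < η₀ ∧ ∀ (t₁ : ℝ) (a θ₀ : ℝ → T3 → ℝ) (u₀ : ℝ → T3 → V3) (ha : ∀ s, Continuous (a s)),
    Continuous (Function.uncurry a) → Continuous (Function.uncurry θ₀) → Continuous (Function.uncurry u₀) →
    ∀ (ha0 : ∀ s x, 0 < a s x), (∀ s x, 0 < θ₀ s x) → ∀ σ : ℝ, 0 < σ → σ < 1 / 2 →
    (∀ s ∈ Set.Icc 0 t₁, σ ^ 3 * (⨆ x, a s x) ≤ η₀ * ∫ x, a s x) →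
    ∀ Φ : (N : ℕ) → HardSphereFlow (Torus.geometry (Fin 3)) (hsDiameter σ N) (N + 1),
    ∀ φ : ℝ → T3 → ℝ, Torus.IsSmoothSpaceTimeOn (Set.Icc 0 t₁) φ →
    ∃ V₀ : ℝ, 0 < V₀ ∧ ∀ V : ℝ, V₀ ≤ V → ∃ β₀ : ℝ, 0 < β₀ ∧ ∀ β : ℝ, |β| ≤ β₀ → ∀ ε : ℝ, 0 < ε →
    ∃ τ₀ : ℝ, 0 < τ₀ ∧ ∀ τ : ℝ, τ₀ ≤ τ → ∃ N₀ : ℕ, ∀ N : ℕ, N₀ ≤ N → ∀ s ∈ Set.Icc 0 t₁,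
      (let ρ₀ : T3 → ℝ := rhoLim (profileOf (a s) (ha s) (ha0 s)) σ
       let w : ℝ := τ * ((N : ℝ) + 1) ^ (-(1 / 3 : ℝ))
       let P := localGibbsLaw σ (a s) (u₀ s) (θ₀ s) N (Φ N)
       let Z : T3 → ℝ := fun x => hsCompressibility (ρ₀ x * σ ^ 3)
       let Z' : T3 → ℝ := fun x => deriv hsCompressibility (ρ₀ x * σ ^ 3)
       let act := fun (i : Fin (N + 1)) (z : Config (N + 1) (Fin 3) T3) =>
         σ / τ * (Φ N).collisionSum (Set.Ioc 0 w) (fun c => if c.fst = i then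
           ‖c.postVel.1 - c.preVel.1‖ + |‖c.postVel.1‖ ^ 2 - ‖c.preVel.1‖ ^ 2| / 2 else 0) z
       let ω := fun (i : Fin (N + 1)) (z : Config (N + 1) (Fin 3) T3) => if act i z ≤ V then (1 : ℝ) else 0
       let Xm := fun (k : Fin 3) (z : Config (N + 1) (Fin 3) T3) =>
         (Φ N).collisionSum (Set.Ioc 0 w)
           (fun c => ω c.fst z * ω c.snd z * ((φ s c.fstPos - φ s c.sndPos) * (c.postVel.1 k - c.preVel.1 k)) / 2) z
       let Am := fun (k : Fin 3) (z : Config (N + 1) (Fin 3) T3) =>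
         (∫ r in (0 : ℝ)..w, ∑ i : Fin (N + 1), Torus.partialDeriv k (φ s) ((Φ N).flow r z i).1 *
           (θ₀ s ((Φ N).flow r z i).1 * (ρ₀ ((Φ N).flow r z i).1 * σ ^ 3) * Z' ((Φ N).flow r z i).1 +
             (1 / 3) * (Z ((Φ N).flow r z i).1 - 1) * ‖((Φ N).flow r z i).2 - u₀ s ((Φ N).flow r z i).1‖ ^ 2)) -
         w * ((N : ℝ) + 1) * ∫ x, ρ₀ x * Torus.partialDeriv k (φ s) x * (θ₀ s x * (ρ₀ x * σ ^ 3) * Z' x)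
       let Xe := fun (z : Config (N + 1) (Fin 3) T3) =>
         (Φ N).collisionSum (Set.Ioc 0 w)
           (fun c => ω c.fst z * ω c.snd z *
             ((φ s c.fstPos - φ s c.sndPos) * ((‖c.postVel.1‖ ^ 2 - ‖c.preVel.1‖ ^ 2) / 2)) / 2) z
       let Ae := fun (z : Config (N + 1) (Fin 3) T3) =>
         (∫ r in (0 : ℝ)..w, ∑ i : Fin (N + 1),
           ((∑ l : Fin 3, u₀ s ((Φ N).flow r z i).1 l * Torus.partialDeriv l (φ s) ((Φ N).flow r z i).1) *
               (θ₀ s ((Φ N).flow r z i).1 * (ρ₀ ((Φ N).flow r z i).1 * σ ^ 3) * Z' ((Φ N).flow r z i).1 +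
                 (1 / 3) * (Z ((Φ N).flow r z i).1 - 1) * ‖((Φ N).flow r z i).2 - u₀ s ((Φ N).flow r z i).1‖ ^ 2) +
             θ₀ s ((Φ N).flow r z i).1 * (Z ((Φ N).flow r z i).1 - 1) *
               (∑ l : Fin 3, Torus.partialDeriv l (φ s) ((Φ N).flow r z i).1 *
                 (((Φ N).flow r z i).2 - u₀ s ((Φ N).flow r z i).1) l))) -
         w * ((N : ℝ) + 1) *
           ∫ x, ρ₀ x * (∑ l : Fin 3, u₀ s x l * Torus.partialDeriv l (φ s) x) * (θ₀ s x * (ρ₀ x * σ ^ 3) * Z' x)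
       (∀ k : Fin 3, ∫⁻ z, ENNReal.ofReal (Real.exp (β * (w⁻¹ * Xm k z - w⁻¹ * Am k z))) ∂P ≤
           ENNReal.ofReal (Real.exp (ε * ((N : ℝ) + 1)))) ∧
         ∫⁻ z, ENNReal.ofReal (Real.exp (β * (w⁻¹ * Xe z - w⁻¹ * Ae z))) ∂P ≤
           ENNReal.ofReal (Real.exp (ε * ((N : ℝ) + 1))))

/-- **The landed chain `inputs ⇒ Grönwall core` as ONE proposition** (`= fun`-free statement of
`HydroLimitInBandOfHeart.gronwallCoreInBand_of_heart oneWindowLedger_holds stub_windowContinuityInBand ⟨…⟩`). -/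
def CoreOfInputs : Prop :=
  OneFlightGossipEngine.KineticCurrentsLDAlongFamilies → LocalClampedTransferWindowLDFamily →
    CoherentSuprathermalContentVanishesW → TwoClocks.TransferActivityTails → OneFlightGossipEngine.EnergyCurrentTails →
    GronwallCoreInBand

/-! ## §1 Stubs (registered; `sorry` only here) — hardest research stub: `stub_kineticCurrentsAlongFamilies` -/

/-- **KCWF — the kinetic fast-currents window LD ALONG FAMILIES** (= item stmt-16659 `OneFlightGossipEngine.KineticCurrentsLDAlongFamilies`,
`Iff.rfl` with the heart's `KineticCurrentsWindowLDFamily`): scale-`N` exponential moments of window averages of one-body fast kinetic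
currents `F ⊥ (1, v, |v|²)` under the local Gibbs laws of a continuous one-parameter reference family, uniformly in the family parameter,
for `|β| ≤ β₀`, every `ε > 0`, windows of `τ ≥ τ₀(ε)` mean free times and `N ≥ N₀`; packing guard `σ³ sup a_s ≤ η₀ ∫ a_s` with `η₀`
OUTERMOST (a statics radius). The fixed-packing wall of the summit in LD currency. -/
theorem stub_kineticCurrentsAlongFamilies : OneFlightGossipEngine.KineticCurrentsLDAlongFamilies := by
  sorry

/-- **LCTF — the LOCAL transfer-clamped collisional window LD ALONG FAMILIES** (child 2 of the 9133 SPLIT-REQUEST; not an item anywhere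
yet): the momentum / energy collisional-transfer rows, clamped at transfer activity `V`, tested with a smooth space-time `φ`, centred by the
explicit local-EOS functional (`Z = hsCompressibility(ρ₀σ³)`, `Z′`), have scale-`N` exponential moments `≤ e^{ε(N+1)}` for `|β| ≤ β₀(V)`,
`τ ≥ τ₀`, `N ≥ N₀`, uniformly along the family; guard `η₀` outermost. -/
theorem stub_localClampedTransferAlongFamilies : LocalClampedTransferWindowLDFamily := by
  sorry

/-- **CSCV-W — the weighted coherent-suprathermal content vanishes under the TRUE law** (child 3 of the 9133 SPLIT-REQUEST; not an item
yet): along a tied classical solution, the per-particle window-averaged suprathermal cubic content carried COHERENTLY (radially weighted mean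
peculiar velocity exceeding `η ×` the cubic content) is `L¹`-negligible for `τ ≥ τ₀(η, ε)`, `N ≥ N₀`. No packing guard (true-law statement). -/
theorem stub_coherentSuprathermalW : CoherentSuprathermalContentVanishesW := by
  sorry

/-- **TAT — transfer-activity tails under the TRUE law** (= item stmt-16624 `TwoClocks.TransferActivityTails`): uniform integrability, at
scale `N`, of the per-particle transfer activity over a kinetic window along a tied classical solution; gives CAT (stmt-13734) and CEAT by
`activityTails_of_transferActivityTails` (LANDED p126055). -/
theorem stub_transferActivityTails : TwoClocks.TransferActivityTails := by
  sorry

/-- **ECT — cubic energy-current tails under the TRUE law** (= item stmt-9235 `OneFlightGossipEngine.EnergyCurrentTails`): uniform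
integrability of `|v|³` at scale `N` along a tied classical solution, at every `s ≤ t < T`. -/
theorem stub_energyCurrentTails : OneFlightGossipEngine.EnergyCurrentTails := by
  sorry

/-- **The landed chain `inputs ⇒ Grönwall core`** — PROVED IN THE TREE in substance (`HydroLimitInBandOfHeart.gronwallCoreInBand_of_heart`,
p122696, fed the sorry-free heart `oneWindowLedger_holds` = one-liner over the LANDED clauses p123605 + p127017, and the LANDED window
continuity p118327; `TransferActivityTails ⇒ CAT ∧ CEAT` by p126055). Registered as a stub ONLY because the strict gate lane cannot verify
importers of `…HydroLimitInBandOfHeart` tonight (hub build of `…ClampedCurrentsDockReduction` incoherent since 21:39Z); NOT a research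
target — the evidence files `inherited-window-clock.lean` (v1b) / `line-inherited-window-clock.lean` (v1) on stmt-17372 discharge it. -/
theorem stub_coreOfInputs : CoreOfInputs := by
  sorry

/-! ## §2 Composition — concludes the crux BY NAME (sorry-free; the six stubs are its hypotheses) -/

/-- **`HydroLimitProfilewiseBand` from the chain and the five inputs**: Grönwall core ⇒ guarded Yau target
(`EntropyClockDock.relEntropyVanishingInBand_of_gronwallCoreInBand`, LANDED p97252) ⇒ uniform band (`hydroLimitInBand_of_relEntropyVanishingInBand`,
LANDED p97115) ⇒ profile-wise band (`profilewiseOfInBand_proof`, item stmt-17373, LANDED p131525). [folklore] -/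
theorem HydroLimitProfilewiseBand_of :
    CoreOfInputs → OneFlightGossipEngine.KineticCurrentsLDAlongFamilies → LocalClampedTransferWindowLDFamily →
      CoherentSuprathermalContentVanishesW → TwoClocks.TransferActivityTails → OneFlightGossipEngine.EnergyCurrentTails →
      ImplosionDichotomy.HydroLimitProfilewiseBand :=
  fun hcore hK hL hC hT hE =>
    profilewiseOfInBand_proof
      (hydroLimitInBand_of_relEntropyVanishingInBand
        (EntropyClockDock.relEntropyVanishingInBand_of_gronwallCoreInBand (hcore hK hL hC hT hE)))

/-- The uniform band on the way (so the skeleton also concludes stmt-9133 by name from the same stubs). [folklore] -/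
theorem hydroLimitInBand_of_inputs (hcore : CoreOfInputs)
    (hK : OneFlightGossipEngine.KineticCurrentsLDAlongFamilies) (hL : LocalClampedTransferWindowLDFamily)
    (hC : CoherentSuprathermalContentVanishesW) (hT : TwoClocks.TransferActivityTails)
    (hE : OneFlightGossipEngine.EnergyCurrentTails) : ImplosionDichotomy.HydroLimitInBand :=
  hydroLimitInBand_of_relEntropyVanishingInBand
    (EntropyClockDock.relEntropyVanishingInBand_of_gronwallCoreInBand (hcore hK hL hC hT hE))

/-- The crux from the registered stubs. -/
theorem HydroLimitProfilewiseBand_proof : ImplosionDichotomy.HydroLimitProfilewiseBand :=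
  HydroLimitProfilewiseBand_of stub_coreOfInputs stub_kineticCurrentsAlongFamilies stub_localClampedTransferAlongFamilies
    stub_coherentSuprathermalW stub_transferActivityTails stub_energyCurrentTails

/-- `activityTails_of_transferActivityTails` is referenced so that the TAT ⇒ CAT ∧ CEAT bridge the sixth stub relies on stays in the
import closure of the skeleton (sanity `example`). -/
example (hT : TwoClocks.TransferActivityTails) :
    OneFlightGossipEngine.CollisionActivityTails := (activityTails_of_transferActivityTails hT).1

end Summit.AtomisticToContinuum.HydrodynamicLimit.Cruxes.HydroLimitProfilewiseBand.InheritedWindowClock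

end
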